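import Summits.ResolutionOfSingularities.ResolutionOfSingularities.Theorems.EquisingularLiftEquisingularLiftNatConePointPresentation
import Summits.ResolutionOfSingularities.ResolutionOfSingularities.Theorems.EquisingularLiftEquisingularLiftNatCarrierDeltaOfPresentation
import Summits.ResolutionOfSingularities.ResolutionOfSingularities.Theorems.EquisingularLiftEquisingularLiftNatUncentredPairLemmas
import Literature.AlgebraicGeometry.Resolution.MvPolynomialKillVars
import HarnessLib

/-!
# [OURS · L1 W4.5(b) · EL♮(3)] HSUB(ReachTC⁺) brick `inv_base`, part 2d (T-AXIS-STALKS): the AXIS of the centred cone at the cone point —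
# its stalk `(c₀, c₁/c₀, c₂/c₀)`, the regular quotient `≅ O`, and its special fibre `= 𝔪_{y′}`

Crux chain w45b (cell `res-hironaka`, slot W4.5(b)), working crux **EL♮** = stmt-ResolutionOfSingularities-20038, child **EL♮(3)** =
stmt-ResolutionOfSingularities-20148, route EquisingularLift, line `sections`, registered stub `stub_elnat_tcPlusPointResolution`;
assembly HSUB(ReachTC⁺)₃ (INV DEFS v3 p532383; brick `inv_base`, CENTRED members; the two hypotheses `hreg` / `hfib` of res-D-pv-051's
B6b T-AXIS-SECTION per res-L1-w45b-plan-1 2026-08-27T14:59:15Z). HONEST FRAMING: OURS; NOT a statement of any manuscript; AI-written,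
weaker than expert review. No `sorry`; standard axioms. `--supports stmt-ResolutionOfSingularities-20148 --as helper`. DEF-FREE.

WHAT. With the frame `c` of `J` at `j x` (quasi-regular, `R/(c) ≅ O` a regular domain, `R = 𝒪_{X',jx}`), the UPSTAIRS chart-`0` presentation
`(𝔔₁, χ₁)` of `𝒪_{X₁,p_c}` at the cone point `p_c = j₂ y′` (res-type-100 B6a `exists_conePoint_presentation`, p541628) and two ideal sheaves
`L₁, L₂` on `X'` with germs `(c₁)`, `(c₂)` at `j x` (prescribed-germ divisors, p534222), the AXIS ideal
`C_axis := (J·𝒪_{X₁} ⊔ St L₁) ⊔ St L₂` satisfies: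
* `isRegularRing_blowupAlgebra_quotient_axis` — `R[I/c₀]/(c₀/1, c₁/c₀, c₂/c₀) ≅ (R/(c))[T₁,T₂]/(T₁,T₂)` is a regular ring;
* **`axis_stalks`** — (1) `(C_axis)_{p_c} = (c₀/1, c₁/c₀, c₂/c₀)·𝒪_{X₁,p_c}`, (2) `𝒪_{X₁,p_c}/(C_axis)_{p_c}` is a regular local ring;
* **`axis_fibre`** — (3) `(C_axis·𝒪_{F₂})_{y′} = 𝔪_{y′}` (with the downstairs T-FRAME-AT presentation of B4a: the three generators go to
  `ῡc̄₀, χ̄(c̄₁/c̄₀), χ̄(c̄₂/c̄₀)`, which generate the prime `𝔔̄` because `R̄[I/c̄₀]/(c̄₀, c̄₁/c̄₀, c̄₂/c̄₀) ≅ k` is a field).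

References: res-type-100 p535966 (F2′), p531747, p541628; res-D-pv-029 p537631 (`apply_frac_mul`); Literature `blowupAlgebraQuotEquiv`,
`MvPolynomial.quotientSpanXEquiv`.
-/

set_option linter.dupNamespace false -- mandated namespace `Summit.<Summit>.<Problem>` of this single-conjunct summit

noncomputable section

open CategoryTheory CategoryTheory.Limits AlgebraicGeometry TopologicalSpace IsLocalRing
open Literature.AlgebraicGeometry.Resolution
open AlgebraicGeometry.Scheme.IdealSheafData

namespace Summit.ResolutionOfSingularities.ResolutionOfSingularities.Cruxes.EquisingularLiftNat.Sections

universe u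

/-! ## Ring level: `R[I/c₀]/(c₀, c₁/c₀, c₂/c₀) ≅ R/(c)` -/

section Ring

variable {R : Type u} [CommRing R] (c : Fin 3 → R)

/-- The variables of `R[T_j : j ≠ 0]` (three homogeneous coordinates) are `T₁` and `T₂`. [folklore] -/
theorem X_image_univ_eq (Λ : Type u) [CommRing Λ] :
    (MvPolynomial.X '' (Set.univ : Set {j : Fin 3 // j ≠ 0}) : Set (MvPolynomial {j : Fin 3 // j ≠ 0} Λ)) =
      {MvPolynomial.X ⟨1, by decide⟩, MvPolynomial.X ⟨2, by decide⟩} := by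
  ext p
  simp only [Set.image_univ, Set.mem_range, Set.mem_insert_iff, Set.mem_singleton_iff]
  constructor
  · rintro ⟨⟨j, hj⟩, rfl⟩
    fin_cases j
    · exact absurd rfl hj
    · exact Or.inl rfl
    · exact Or.inr rfl
  · rintro (rfl | rfl)
    · exact ⟨_, rfl⟩
    · exact ⟨_, rfl⟩

set_option synthInstance.maxHeartbeats 200000 in -- instances on the double quotient of the chart algebra (subalgebra of a localisation)
/-- **The axis quotient of the chart algebra is a regular ring**: for `c` quasi-regular with `R/(c)` a regular ring,
`R[I/c₀]/(c₀/1, c₁/c₀, c₂/c₀) ≅ (R/(c))[T₁,T₂]/(T₁,T₂) ≅ R/(c)` (tree `blowupAlgebraQuotEquiv`, `MvPolynomial.quotientSpanXEquiv`).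
[cite: StacksProject, Tag 0BIQ] -/
theorem isRegularRing_blowupAlgebra_quotient_axis (hc : IsQuasiRegular c) [IsRegularRing (R ⧸ Ideal.span (Set.range c))] :
    IsRegularRing (blowupAlgebra (Ideal.span (Set.range c)) (c 0) ⧸
      (Ideal.span {algebraMap R (blowupAlgebra (Ideal.span (Set.range c)) (c 0)) (c 0)} ⊔
        Ideal.span {blowupAlgebra.frac c 0 1, blowupAlgebra.frac c 0 2})) := by
  -- `B/(c₀) ≅ P = (R/(c))[T_j : j ≠ 0]`
  let e₁ : (blowupAlgebra (Ideal.span (Set.range c)) (c 0) ⧸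
      Ideal.span {algebraMap R (blowupAlgebra (Ideal.span (Set.range c)) (c 0)) (c 0)}) ≃+*
      MvPolynomial {j : Fin 3 // j ≠ 0} (R ⧸ Ideal.span (Set.range c)) := (blowupAlgebraQuotEquiv c 0 hc).symm
  have he₁ : ∀ j : {j : Fin 3 // j ≠ 0}, e₁ (Ideal.Quotient.mk _ (blowupAlgebra.frac c 0 j.1)) = MvPolynomial.X j := fun j => by
    change (blowupAlgebraQuotEquiv c 0 hc).symm _ = _
    rw [RingEquiv.symm_apply_eq, blowupAlgebraQuotEquiv_X]
  -- the image of `(c₁/c₀, c₂/c₀)` is `(T₁, T₂)`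
  have himg : Ideal.span (MvPolynomial.X '' (Set.univ : Set {j : Fin 3 // j ≠ 0}) :
      Set (MvPolynomial {j : Fin 3 // j ≠ 0} (R ⧸ Ideal.span (Set.range c)))) =
      ((Ideal.span {blowupAlgebra.frac c 0 1, blowupAlgebra.frac c 0 2}).map (Ideal.Quotient.mk
        (Ideal.span {algebraMap R (blowupAlgebra (Ideal.span (Set.range c)) (c 0)) (c 0)}))).map e₁.toRingHom := by
    rw [X_image_univ_eq, Ideal.map_map, Ideal.map_span, Set.image_pair]
    congr 1
    change _ = {e₁ (Ideal.Quotient.mk _ _), e₁ (Ideal.Quotient.mk _ _)}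
    rw [he₁ ⟨1, by decide⟩, he₁ ⟨2, by decide⟩]
  let e₂ := (DoubleQuot.quotQuotEquivQuotSup (Ideal.span {algebraMap R (blowupAlgebra (Ideal.span (Set.range c)) (c 0)) (c 0)})
    (Ideal.span {blowupAlgebra.frac c 0 1, blowupAlgebra.frac c 0 2})).symm.trans
    ((Ideal.quotientEquiv _ _ e₁ himg).trans
      (MvPolynomial.quotientSpanXEquiv (R := R ⧸ Ideal.span (Set.range c)) (Set.univ : Set {j : Fin 3 // j ≠ 0})).toRingEquiv)
  exact IsRegularRing.of_ringEquiv e₂.symm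

end Ring

/-! ## The axis at the cone point: stalk and regular quotient -/

section Stalk

set_option maxHeartbeats 800000 in -- three chart-algebra stalk computations on the given presentation (cf. p535966)
/-- **T-AXIS-STALKS (1)+(2).** See the module docstring. [cite: StacksProject, Tag 0804] -/
theorem axis_stalks {X' X₁ : Scheme.{0}} [IsLocallyNoetherian X₁] {J : X'.IdealSheafData} {τ₁ : X₁ ⟶ X'}
    (L₁ L₂ : X'.IdealSheafData) (p₁ : X₁) (p : X') (hpc : τ₁ p₁ = p) (hpJ : p ∈ (J.support : Set X'))
    (c : Fin 3 → X'.presheaf.stalk p) (hcJ : Ideal.span (Set.range c) = stalkIdeal J p) (hc : IsQuasiRegular c)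
    [IsDomain (X'.presheaf.stalk p ⧸ Ideal.span (Set.range c))] [IsRegularRing (X'.presheaf.stalk p ⧸ Ideal.span (Set.range c))]
    (hL₁ : stalkIdeal L₁ p = Ideal.span {c 1}) (hL₂ : stalkIdeal L₂ p = Ideal.span {c 2})
    (𝔔₁ : PrimeSpectrum (blowupAlgebra (Ideal.span (Set.range c)) (c 0)))
    (χ₁ : blowupAlgebra (Ideal.span (Set.range c)) (c 0) →+* X₁.presheaf.stalk p₁)
    (hχ₁ : ∀ a, χ₁ (algebraMap _ _ a) = ((X'.presheaf.stalkCongr (Inseparable.of_eq hpc)).inv ≫ τ₁.stalkMap p₁).hom a)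
    (hloc₁ : @IsLocalization.AtPrime _ _ (X₁.presheaf.stalk p₁) _ χ₁.toAlgebra 𝔔₁.asIdeal _)
    (h𝔔₁ : 𝔔₁.asIdeal.comap (algebraMap _ (blowupAlgebra (Ideal.span (Set.range c)) (c 0))) = maximalIdeal (X'.presheaf.stalk p))
    (hu : ∀ l : Fin 3, l ≠ 0 → χ₁ (blowupAlgebra.frac c 0 l) ∈ maximalIdeal (X₁.presheaf.stalk p₁)) :
    stalkIdeal ((J.comap τ₁ ⊔ strictTransformIdeal τ₁ J L₁) ⊔ strictTransformIdeal τ₁ J L₂) p₁ =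
      (Ideal.span {algebraMap _ (blowupAlgebra (Ideal.span (Set.range c)) (c 0)) (c 0)} ⊔
        Ideal.span {blowupAlgebra.frac c 0 1, blowupAlgebra.frac c 0 2}).map χ₁ ∧
    IsRegularLocalRing (X₁.presheaf.stalk p₁ ⧸
      stalkIdeal ((J.comap τ₁ ⊔ strictTransformIdeal τ₁ J L₁) ⊔ strictTransformIdeal τ₁ J L₂) p₁) := by
  letI := χ₁.toAlgebra
  haveI : IsLocalization.AtPrime (X₁.presheaf.stalk p₁) 𝔔₁.asIdeal := hloc₁
  -- the two linear cones `L_l = V(c_l)`: `Φ = T_l`, `St(L_l)_{p₁} = (χ₁ (c_l/c₀))`, `E_{p₁} = (χ₁ (c₀/1))`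
  have hX : ∀ l : Fin 3, MvPolynomial.map (Ideal.Quotient.mk (Ideal.span (Set.range c)))
      (MvPolynomial.X l : MvPolynomial (Fin 3) (X'.presheaf.stalk p)) ≠ 0 := fun l => by
    rw [MvPolynomial.map_X]; exact MvPolynomial.X_ne_zero l
  have hK₁ : stalkIdeal L₁ p = Ideal.span {MvPolynomial.eval c (MvPolynomial.X 1)} := by rw [MvPolynomial.eval_X]; exact hL₁
  have hK₂ : stalkIdeal L₂ p = Ideal.span {MvPolynomial.eval c (MvPolynomial.X 2)} := by rw [MvPolynomial.eval_X]; exact hL₂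
  obtain ⟨hE, hSt₁, -, -⟩ := stalkIdeal_carrierDelta_of_presentation L₁ p₁ p hpc hpJ c hcJ hc (MvPolynomial.X 1)
    (MvPolynomial.isHomogeneous_X _ 1) (hX 1) hK₁ 0 𝔔₁ χ₁ hχ₁ hloc₁ h𝔔₁
  obtain ⟨-, hSt₂, -, -⟩ := stalkIdeal_carrierDelta_of_presentation L₂ p₁ p hpc hpJ c hcJ hc (MvPolynomial.X 2)
    (MvPolynomial.isHomogeneous_X _ 2) (hX 2) hK₂ 0 𝔔₁ χ₁ hχ₁ hloc₁ h𝔔₁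
  rw [MvPolynomial.aeval_X] at hSt₁ hSt₂
  have h1 : stalkIdeal ((J.comap τ₁ ⊔ strictTransformIdeal τ₁ J L₁) ⊔ strictTransformIdeal τ₁ J L₂) p₁ =
      (Ideal.span {algebraMap _ (blowupAlgebra (Ideal.span (Set.range c)) (c 0)) (c 0)} ⊔
        Ideal.span {blowupAlgebra.frac c 0 1, blowupAlgebra.frac c 0 2}).map χ₁ := by
    rw [stalkIdeal_sup, stalkIdeal_sup, hE, hSt₁, hSt₂, Ideal.map_sup, Ideal.map_span, Ideal.map_span, Set.image_singleton,
      Set.image_pair, sup_assoc]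
    congr 1
    rw [← Ideal.span_union, Set.singleton_union]
  refine ⟨h1, ?_⟩
  -- the ideal lies in `𝔔₁`, and `B/𝔞` is a regular ring
  have h𝔞𝔔 : Ideal.span {algebraMap _ (blowupAlgebra (Ideal.span (Set.range c)) (c 0)) (c 0)} ⊔
      Ideal.span {blowupAlgebra.frac c 0 1, blowupAlgebra.frac c 0 2} ≤ 𝔔₁.asIdeal := by
    refine sup_le ((Ideal.span_singleton_le_iff_mem _).mpr ?_) ?_
    · rw [← Ideal.mem_comap, h𝔔₁]
      have h := (mem_support_iff_stalkIdeal_le J p).mp hpJ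
      rw [← hcJ] at h
      exact h (Ideal.subset_span (Set.mem_range_self 0))
    · rw [Ideal.span_le]
      rintro b (rfl | rfl)
      · exact (IsLocalization.AtPrime.to_map_mem_maximal_iff (X₁.presheaf.stalk p₁) 𝔔₁.asIdeal _).mp (hu 1 (by decide))
      · exact (IsLocalization.AtPrime.to_map_mem_maximal_iff (X₁.presheaf.stalk p₁) 𝔔₁.asIdeal _).mp (hu 2 (by decide))
  haveI := isRegularRing_blowupAlgebra_quotient_axis c hc
  have hS := isRegularLocalRing_quotient_map_of_isRegularRing_quotient (S := X₁.presheaf.stalk p₁) 𝔔₁.asIdeal _ h𝔞𝔔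
  rw [h1]
  exact hS

end Stalk

/-! ## The special fibre of the axis at `y′` is the reduced point -/

section Fibre

set_option synthInstance.maxHeartbeats 200000 in -- instances on the double quotient of the chart algebra (subalgebra of a localisation)
/-- In the chart algebra of a frame `c̄` generating the maximal ideal of a local ring with residue FIELD, the axis ideal
`(c̄₀/1, c̄₁/c̄₀, c̄₂/c̄₀)` is maximal (its quotient is the residue field). [folklore] -/
theorem isMaximal_span_axis {R : Type u} [CommRing R] (c : Fin 3 → R) (hc : IsQuasiRegular c)
    [IsField' : Fact (IsField (R ⧸ Ideal.span (Set.range c)))] :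
    (Ideal.span {algebraMap R (blowupAlgebra (Ideal.span (Set.range c)) (c 0)) (c 0)} ⊔
      Ideal.span {blowupAlgebra.frac c 0 1, blowupAlgebra.frac c 0 2}).IsMaximal := by
  letI : Field (R ⧸ Ideal.span (Set.range c)) := IsField'.out.toField
  let e₁ : (blowupAlgebra (Ideal.span (Set.range c)) (c 0) ⧸
      Ideal.span {algebraMap R (blowupAlgebra (Ideal.span (Set.range c)) (c 0)) (c 0)}) ≃+*
      MvPolynomial {j : Fin 3 // j ≠ 0} (R ⧸ Ideal.span (Set.range c)) := (blowupAlgebraQuotEquiv c 0 hc).symm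
  have he₁ : ∀ j : {j : Fin 3 // j ≠ 0}, e₁ (Ideal.Quotient.mk _ (blowupAlgebra.frac c 0 j.1)) = MvPolynomial.X j := fun j => by
    change (blowupAlgebraQuotEquiv c 0 hc).symm _ = _
    rw [RingEquiv.symm_apply_eq, blowupAlgebraQuotEquiv_X]
  have himg : Ideal.span (MvPolynomial.X '' (Set.univ : Set {j : Fin 3 // j ≠ 0}) :
      Set (MvPolynomial {j : Fin 3 // j ≠ 0} (R ⧸ Ideal.span (Set.range c)))) =
      ((Ideal.span {blowupAlgebra.frac c 0 1, blowupAlgebra.frac c 0 2}).map (Ideal.Quotient.mk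
        (Ideal.span {algebraMap R (blowupAlgebra (Ideal.span (Set.range c)) (c 0)) (c 0)}))).map e₁.toRingHom := by
    rw [X_image_univ_eq, Ideal.map_map, Ideal.map_span, Set.image_pair]
    congr 1
    change _ = {e₁ (Ideal.Quotient.mk _ _), e₁ (Ideal.Quotient.mk _ _)}
    rw [he₁ ⟨1, by decide⟩, he₁ ⟨2, by decide⟩]
  let e₂ := (DoubleQuot.quotQuotEquivQuotSup (Ideal.span {algebraMap R (blowupAlgebra (Ideal.span (Set.range c)) (c 0)) (c 0)})
    (Ideal.span {blowupAlgebra.frac c 0 1, blowupAlgebra.frac c 0 2})).symm.trans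
    ((Ideal.quotientEquiv _ _ e₁ himg).trans
      (MvPolynomial.quotientSpanXEquiv (R := R ⧸ Ideal.span (Set.range c)) (Set.univ : Set {j : Fin 3 // j ≠ 0})).toRingEquiv)
  -- the target is a polynomial ring in NO variables over a field: a field
  haveI : IsEmpty {j : {j : Fin 3 // j ≠ 0} // j ∉ (Set.univ : Set {j : Fin 3 // j ≠ 0})} :=
    ⟨fun j => j.2 (Set.mem_univ _)⟩
  have hF : IsField (MvPolynomial {j : {j : Fin 3 // j ≠ 0} // j ∉ (Set.univ : Set {j : Fin 3 // j ≠ 0})}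
      (R ⧸ Ideal.span (Set.range c))) :=
    (MvPolynomial.isEmptyRingEquiv _ _).toMulEquiv.isField (Field.toIsField _)
  exact Ideal.Quotient.maximal_of_isField _ (MulEquiv.isField hF e₂.toMulEquiv)

set_option maxHeartbeats 800000 in -- up/down chart-algebra presentations and the stalk transport of the square (cf. p541628)
/-- **T-AXIS-STALKS (3): the special fibre of the axis at `y′` is the reduced point `y′`.** See the module docstring.
[cite: StacksProject, Tag 0804] -/
theorem axis_fibre {X' X₁ F₁ F₂ : Scheme.{0}} [IsLocallyNoetherian X₁] [IsLocallyNoetherian F₂]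
    {J : X'.IdealSheafData} {τ₁ : X₁ ⟶ X'} (L₁ L₂ : X'.IdealSheafData) (j : F₁ ⟶ X') {x : F₁}
    (hx : IsClosed ({x} : Set F₁)) {υ : F₂ ⟶ F₁} (hυ : IsBlowup υ (vanishingIdeal ⟨{x}, hx⟩)) (j₂ : F₂ ⟶ X₁)
    (hcomm : j₂ ≫ τ₁ = υ ≫ j) (c : Fin 3 → X'.presheaf.stalk (j x)) (hcJ : Ideal.span (Set.range c) = stalkIdeal J (j x))
    (hc : IsQuasiRegular c) [IsDomain (X'.presheaf.stalk (j x) ⧸ Ideal.span (Set.range c))]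
    [IsRegularRing (X'.presheaf.stalk (j x) ⧸ Ideal.span (Set.range c))]
    (hcb : Ideal.span (Set.range fun i => (j.stalkMap x).hom (c i)) = maximalIdeal (F₁.presheaf.stalk x))
    (hcbar : IsQuasiRegular (fun i => (j.stalkMap x).hom (c i)))
    (hL₁ : stalkIdeal L₁ (j x) = Ideal.span {c 1}) (hL₂ : stalkIdeal L₂ (j x) = Ideal.span {c 2})
    (y' : F₂) (hy'x : υ y' = x) (hpc : τ₁ (j₂ y') = j x) (hpJ : j x ∈ (J.support : Set X'))
    -- upstairs presentation (B6a)
    (𝔔₁ : PrimeSpectrum (blowupAlgebra (Ideal.span (Set.range c)) (c 0)))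
    (χ₁ : blowupAlgebra (Ideal.span (Set.range c)) (c 0) →+* X₁.presheaf.stalk (j₂ y'))
    (hχ₁ : ∀ a, χ₁ (algebraMap _ _ a) = ((X'.presheaf.stalkCongr (Inseparable.of_eq hpc)).inv ≫ τ₁.stalkMap (j₂ y')).hom a)
    (hloc₁ : @IsLocalization.AtPrime _ _ (X₁.presheaf.stalk (j₂ y')) _ χ₁.toAlgebra 𝔔₁.asIdeal _)
    (h𝔔₁ : 𝔔₁.asIdeal.comap (algebraMap _ (blowupAlgebra (Ideal.span (Set.range c)) (c 0))) = maximalIdeal (X'.presheaf.stalk (j x)))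
    -- downstairs presentation (T-FRAME-AT, packed as output by B4a)
    (Hp : ∃ (𝔔 : PrimeSpectrum (blowupAlgebra (Ideal.span (Set.range fun i => (j.stalkMap x).hom (c i)))
        ((j.stalkMap x).hom (c 0))))
      (χ : blowupAlgebra (Ideal.span (Set.range fun i => (j.stalkMap x).hom (c i))) ((j.stalkMap x).hom (c 0)) →+*
        F₂.presheaf.stalk y')
      (e : F₂.presheaf.stalk y' ≃+* Localization.AtPrime 𝔔.asIdeal),
      (∀ a, χ (algebraMap _ _ a) = ((F₁.presheaf.stalkCongr (Inseparable.of_eq hy'x)).inv ≫ υ.stalkMap y').hom a) ∧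
      @IsLocalization.AtPrime _ _ (F₂.presheaf.stalk y') _ χ.toAlgebra 𝔔.asIdeal _ ∧
      (∀ b, e (χ b) = algebraMap _ (Localization.AtPrime 𝔔.asIdeal) b) ∧
      𝔔.asIdeal.comap (algebraMap _ (blowupAlgebra (Ideal.span (Set.range fun i => (j.stalkMap x).hom (c i)))
        ((j.stalkMap x).hom (c 0)))) = maximalIdeal (F₁.presheaf.stalk x) ∧
      ∀ (l : {l : Fin 3 // l ≠ 0}) (y : blowupAlgebra (Ideal.span (Set.range fun i => (j.stalkMap x).hom (c i)))
          ((j.stalkMap x).hom (c 0))),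
        (y : Localization.Away ((j.stalkMap x).hom (c 0))) =
          algebraMap _ (Localization.Away ((j.stalkMap x).hom (c 0))) ((j.stalkMap x).hom (c l.1)) *
            IsLocalization.Away.invSelf ((j.stalkMap x).hom (c 0)) → y ∈ 𝔔.asIdeal) :
    stalkIdeal (((J.comap τ₁ ⊔ strictTransformIdeal τ₁ J L₁) ⊔ strictTransformIdeal τ₁ J L₂).comap j₂) y' =
      maximalIdeal (F₂.presheaf.stalk y') := by
  subst hy'x
  letI := χ₁.toAlgebra
  haveI : IsLocalization.AtPrime (X₁.presheaf.stalk (j₂ y')) 𝔔₁.asIdeal := hloc₁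
  -- the upstairs axis stalk
  have hX : ∀ l : Fin 3, MvPolynomial.map (Ideal.Quotient.mk (Ideal.span (Set.range c)))
      (MvPolynomial.X l : MvPolynomial (Fin 3) (X'.presheaf.stalk (j (υ y')))) ≠ 0 := fun l => by
    rw [MvPolynomial.map_X]; exact MvPolynomial.X_ne_zero l
  have hK₁ : stalkIdeal L₁ (j (υ y')) = Ideal.span {MvPolynomial.eval c (MvPolynomial.X 1)} := by
    rw [MvPolynomial.eval_X]; exact hL₁
  have hK₂ : stalkIdeal L₂ (j (υ y')) = Ideal.span {MvPolynomial.eval c (MvPolynomial.X 2)} := by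
    rw [MvPolynomial.eval_X]; exact hL₂
  obtain ⟨hE₁, hSt₁, -, -⟩ := stalkIdeal_carrierDelta_of_presentation L₁ (j₂ y') (j (υ y')) hpc hpJ c hcJ hc (MvPolynomial.X 1)
    (MvPolynomial.isHomogeneous_X _ 1) (hX 1) hK₁ 0 𝔔₁ χ₁ hχ₁ hloc₁ h𝔔₁
  obtain ⟨-, hSt₂, -, -⟩ := stalkIdeal_carrierDelta_of_presentation L₂ (j₂ y') (j (υ y')) hpc hpJ c hcJ hc (MvPolynomial.X 2)
    (MvPolynomial.isHomogeneous_X _ 2) (hX 2) hK₂ 0 𝔔₁ χ₁ hχ₁ hloc₁ h𝔔₁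
  rw [MvPolynomial.aeval_X] at hSt₁ hSt₂
  -- transport of the square on the three generators (as in B6a)
  have hφ : ∀ a : X'.presheaf.stalk (j (υ y')),
      (j₂.stalkMap y').hom (((X'.presheaf.stalkCongr (Inseparable.of_eq hpc)).inv ≫ τ₁.stalkMap (j₂ y')).hom a) =
        (υ.stalkMap y').hom ((j.stalkMap (υ y')).hom a) := by
    -- adapted from `exists_conePoint_presentation` (res-type-100, p541628) / …NatCarrierDeltaComap (res-D-pv-029)
    intro a
    have h1 : (j₂ ≫ τ₁).stalkMap y' = (X'.presheaf.stalkCongr (.of_eq (by rw [hcomm]))).hom ≫ (υ ≫ j).stalkMap y' :=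
      Scheme.Hom.stalkMap_congr_hom _ _ hcomm y'
    have h2 : ∀ z, (j₂.stalkMap y').hom ((τ₁.stalkMap (j₂ y')).hom z) = ((j₂ ≫ τ₁).stalkMap y').hom z := fun z => by
      rw [Scheme.Hom.stalkMap_comp]; rfl
    have h3 : ((X'.presheaf.stalkCongr (.of_eq (by rw [hcomm]) : Inseparable ((j₂ ≫ τ₁) y') ((υ ≫ j) y'))).hom)
        ((X'.presheaf.stalkCongr (Inseparable.of_eq hpc)).inv a) = a := by
      change ((X'.presheaf.stalkCongr (Inseparable.of_eq hpc)).inv ≫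
        (X'.presheaf.stalkCongr (Inseparable.of_eq hpc)).hom) a = a
      rw [Iso.inv_hom_id]; rfl
    have h4 : ∀ b, ((υ ≫ j).stalkMap y').hom b = (υ.stalkMap y').hom ((j.stalkMap (υ y')).hom b) := fun b => by
      rw [Scheme.Hom.stalkMap_comp]; rfl
    rw [CommRingCat.comp_apply, h2, h1, CommRingCat.hom_comp, RingHom.comp_apply, ← h4]
    exact congrArg _ h3
  have hυ' : ∀ a, ((F₁.presheaf.stalkCongr (Inseparable.of_eq (rfl : υ y' = υ y'))).inv ≫ υ.stalkMap y').hom a =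
      (υ.stalkMap y').hom a := fun a => by simp [TopCat.Presheaf.stalkCongr]
  refine Hp.elim fun 𝔔 H => H.elim fun χ H => H.elim fun e H => ?_
  have hχ : ∀ a, χ (algebraMap _ _ a) = (υ.stalkMap y').hom a := fun a => (H.1 a).trans (hυ' a)
  have hloc := H.2.1
  have h𝔔 := H.2.2.2.1
  have hvan := H.2.2.2.2
  letI := χ.toAlgebra
  haveI : IsLocalization.AtPrime (F₂.presheaf.stalk y') 𝔔.asIdeal := hloc
  -- `ῡ c̄₀` is a non-zero-divisor
  have hEd : stalkIdeal ((vanishingIdeal ⟨{υ y'}, hx⟩ : F₁.IdealSheafData).comap υ) y' =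
      Ideal.span {(υ.stalkMap y').hom ((j.stalkMap (υ y')).hom (c 0))} := by
    rw [stalkIdeal_comap_eq_map_stalkMap, stalkIdeal_vanishingIdeal_singleton hx, ← hcb,
      show (υ.stalkMap y').hom = χ.comp (algebraMap _ _) from RingHom.ext fun a => (hχ a).symm, ← Ideal.map_map,
      map_blowupAlgebra_eq_span (Ideal.subset_span ⟨0, rfl⟩ : (j.stalkMap (υ y')).hom (c 0) ∈
        Ideal.span (Set.range fun i => (j.stalkMap (υ y')).hom (c i))), Ideal.map_span, Set.image_singleton]
    rfl
  have ht0 : (υ.stalkMap y').hom ((j.stalkMap (υ y')).hom (c 0)) ∈ nonZeroDivisors (F₂.presheaf.stalk y') := by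
    obtain ⟨t, ht, hKt⟩ := hυ.isEffectiveCartier.exists_stalkIdeal_eq_span y'
    rw [hEd] at hKt
    obtain ⟨w, hw⟩ := Ideal.mem_span_singleton'.mp (hKt ▸ Ideal.mem_span_singleton_self _ :
      (υ.stalkMap y').hom ((j.stalkMap (υ y')).hom (c 0)) ∈ Ideal.span {t})
    rw [← hw]
    exact mul_mem_nonZeroDivisors.mpr ⟨(isUnit_of_span_singleton_eq_of_mul_eq hKt ht hw).mem_nonZeroDivisors, ht⟩
  -- the three generators downstairs
  have hgen0 : (j₂.stalkMap y').hom (χ₁ (algebraMap _ _ (c 0))) = χ (algebraMap _ _ ((j.stalkMap (υ y')).hom (c 0))) := by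
    rw [hχ₁, hφ, hχ]
  have hgenl : ∀ l : Fin 3, (j₂.stalkMap y').hom (χ₁ (blowupAlgebra.frac c 0 l)) =
      χ (blowupAlgebra.frac (fun i => (j.stalkMap (υ y')).hom (c i)) 0 l) := by
    intro l
    have hup := apply_frac_mul c 0 l χ₁ _ hχ₁
    have hdown := apply_frac_mul (fun i => (j.stalkMap (υ y')).hom (c i)) 0 l χ _ hχ
    refine sub_eq_zero.mp ((mul_right_mem_nonZeroDivisors_eq_zero_iff ht0).mp ?_)
    have h1 := congrArg (j₂.stalkMap y').hom hup
    rw [map_mul, hφ, hφ] at h1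
    rw [sub_mul, h1, hdown, sub_self]
  -- the downstairs axis ideal is the prime `𝔔` (its quotient is the residue field)
  haveI : Fact (IsField (F₁.presheaf.stalk (υ y') ⧸ Ideal.span (Set.range fun i => (j.stalkMap (υ y')).hom (c i)))) :=
    ⟨by rw [hcb, ← Ideal.Quotient.maximal_ideal_iff_isField_quotient]; exact maximalIdeal.isMaximal _⟩
  have hmax := isMaximal_span_axis (fun i => (j.stalkMap (υ y')).hom (c i)) hcbar
  have h𝔞le : Ideal.span {algebraMap _ (blowupAlgebra (Ideal.span (Set.range fun i => (j.stalkMap (υ y')).hom (c i)))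
      ((j.stalkMap (υ y')).hom (c 0))) ((j.stalkMap (υ y')).hom (c 0))} ⊔
      Ideal.span {blowupAlgebra.frac (fun i => (j.stalkMap (υ y')).hom (c i)) 0 1,
        blowupAlgebra.frac (fun i => (j.stalkMap (υ y')).hom (c i)) 0 2} ≤ 𝔔.asIdeal := by
    refine sup_le ((Ideal.span_singleton_le_iff_mem _).mpr ?_) ?_
    · rw [← Ideal.mem_comap, h𝔔, ← hcb]
      exact Ideal.subset_span ⟨0, rfl⟩
    · rw [Ideal.span_le]
      rintro b (rfl | rfl)
      · exact hvan ⟨1, by decide⟩ _ (blowupAlgebra.coe_frac _ 0 1)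
      · exact hvan ⟨2, by decide⟩ _ (blowupAlgebra.coe_frac _ 0 2)
  have h𝔞eq := hmax.eq_of_le 𝔔.isPrime.ne_top h𝔞le
  -- `χ₁ (c_l/c₀) ∈ 𝔪`: its image under the local map `j₂^♯` is `χ̄(c̄_l/c̄₀) ∈ 𝔪_{y′}`
  have hu₁ : ∀ l : Fin 3, l ≠ 0 → χ₁ (blowupAlgebra.frac c 0 l) ∈ maximalIdeal (X₁.presheaf.stalk (j₂ y')) := by
    intro l hl
    have hdown𝔪 : χ (blowupAlgebra.frac (fun i => (j.stalkMap (υ y')).hom (c i)) 0 l) ∈ maximalIdeal (F₂.presheaf.stalk y') :=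
      (IsLocalization.AtPrime.to_map_mem_maximal_iff (F₂.presheaf.stalk y') 𝔔.asIdeal _).mpr
        (hvan ⟨l, hl⟩ _ (blowupAlgebra.coe_frac _ 0 l))
    rw [← hgenl] at hdown𝔪
    exact (map_mem_nonunits_iff (j₂.stalkMap y').hom _).mp hdown𝔪
  -- conclude
  obtain ⟨hax, -⟩ := axis_stalks L₁ L₂ (j₂ y') (j (υ y')) hpc hpJ c hcJ hc hL₁ hL₂ 𝔔₁ χ₁ hχ₁ hloc₁ h𝔔₁ hu₁
  rw [stalkIdeal_comap_eq_map_stalkMap, hax, Ideal.map_map, Ideal.map_sup, Ideal.map_span, Ideal.map_span,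
    Set.image_singleton, Set.image_pair, RingHom.comp_apply, RingHom.comp_apply, RingHom.comp_apply, hgen0, hgenl, hgenl,
    ← IsLocalization.AtPrime.map_eq_maximalIdeal 𝔔.asIdeal (F₂.presheaf.stalk y'), ← h𝔞eq, Ideal.map_sup, Ideal.map_span,
    Ideal.map_span, Set.image_singleton, Set.image_pair]
  rfl

end Fibre

end Summit.ResolutionOfSingularities.ResolutionOfSingularities.Cruxes.EquisingularLiftNat.Sections

end
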